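import Literature.MathematicalPhysics.QuantumFieldTheory.Federbush1986.PhaseCellIVThmA34Repaired

/-!
# Federbush, *A phase cell approach to Yang–Mills theory. IV* (CMP **114** (1988) 317–343), Appendix A —
# Theorems A.3 / A.4: the UNCAPPED re-typings `ThmA3Cont` / `ThmA4Cont` FAIL for `M = S¹ ⊂ ℝ²`, `n = 2`
# (kernel decision between the two re-typed readings; the CAPPED forms `ThmA3ContCap` / `ThmA4ContCap`,
# p. 339 «Caution», are the statements print proves)

statement-level skeleton of published theorems with citation tags; proofs where landed; nothing here is a claim about the Yang–Mills mass gap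

Cell `lit-balaban`, reader/typer **r19** (gen 6; F4 fold owner); SKELETON rows `F4.ThmA.3`, `F4.ThmA.4` (referee ref-5).
Source: P. Federbush, Commun. Math. Phys. **114** (1988) 317–343 [bib `Federbush1988PhaseCellIV`], Appendix A, Theorem
A.3 (A.25)–(A.26) p. 342 [PDF 26], Theorem A.4 (A.32)–(A.36) pp. 342–343 [PDF 26–27], and §11 p. 339 [PDF 23]: «Caution.
The geometric theorems of Appendix A, require a universal bound on `Λ₁` of `φ`'s (as scaled to unit scale)» (renders
`run/shared/lean/pub/lit-balaban/lit-balaban-r19/renders/f4/f4-p023.png`, `-p026.png`, `-p027.png`, read by this seat).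

WHY.  After GAPS.md §G-F4-01 two re-typings of Theorems A.3/A.4 are on file (`PhaseCellIVThmA34Repaired`, p251310 /
p251889): the UNCAPPED `ThmA3Cont n t M` / `ThmA4Cont n t M` — (A.26)/(A.36) read literally, ONE sequence of constants
`c_α` serving every Lipschitz datum `f` — and the CAPPED `ThmA3ContCap` / `ThmA4ContCap` — constants `c_α = c_α(c₁)` for
data with `Λ₁(f) ≤ c₁`, the p. 339 «Caution» built in (the printed proof, mollification at scale `εd(x)` + normal
projection `Pr_M`, delivers exactly this).  Which one is the row's declaration of record was left to the fold owner.  This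
file DECIDES it in the kernel: the uncapped reading is FALSE already for the simplest compact target print allows, the unit
circle `M = S¹ ⊂ ℝ²` (`t = 2`) and the disc `n = 2`:

* `not_thmA3Cont_two_circle : ¬ ThmA3Cont 2 2 (sphere 0 1)`,
* `not_thmA4Cont_two_circle : ¬ ThmA4Cont 2 2 (sphere 0 1)`.

Hence the decls of record for rows F4.ThmA.3 / F4.ThmA.4 are the CAPPED forms `ThmA3ContCap` / `ThmA4ContCap` (print WITH
its «Caution»); the uncapped defs stay on file as the refuted literal reading.  Nothing printed fails: p. 339 says the
theorems need the cap.

THE OBSTRUCTION (our argument; print gives none — it is the standard degree/energy obstruction for circle-valued maps).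
Datum `f(x) = e^{iKx₀}` (values in `S¹`, Lipschitz constant `K`).  Let `f^s` be continuous on the closed disc with values
in `S¹`, `C²` inside, `= f` on the circle, with `‖Df^s‖ ≤ C₁` and `‖D²f^s(x)‖·(1 − |x|) ≤ C₂` inside.  Along the chord at
height `h`, parametrised trigonometrically `P_h(τ) = (√(1−h²) sin τ, h)`, `τ ∈ [−π/2, π/2]`, the curve `φ = f^s ∘ P_h`
is unit-modulus, so `|φ′|² = −Re(φ̄φ″) ≤ |φ″| ≤ 2C₂ + C₁` (the trigonometric speed `(1−h²)cos²τ = 1 − |P|² ≤ 2(1 − |P|)`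
absorbs the blow-up of `D²f^s` at the boundary).  The accumulated angle `A(h) = ∫ Im(φ̄φ′)` satisfies
`e^{iA(h)} = φ(π/2)/φ(−π/2) = e^{2iK√(1−h²)}`, so `A(h) − 2K√(1−h²) ∈ 2πℤ`; `A` is continuous in `h` (dominated
convergence), the chords shrink to the pole `(0,1)` where `f^s` is continuous, so the integer vanishes near `h = 1` and
hence at every `h` (intermediate values); at `h = h₀` this gives `2K√(1−h₀²) = A(h₀) ≤ π√(2C₂ + C₁)`
(`chord_obstruction`).  With the uncapped (A.26), `C₁ = |c₁|K`, `C₂ = |c₂|K`, `h₀ = 0`: `4K ≤ π²(2|c₂| + |c₁|)` for EVERY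
`K` — false for `K = 4(2|c₂| + |c₁|) + 1`.  With the uncapped (A.36) (`x₀ = 0`, chords at heights `h ≥ 1/2`, where
`|x|⁻¹ ≤ 2` and `d(x, ∂B ∪ {0}) = 1 − |x|`): `3K ≤ 2π²(2|c₂| + |c₁|)`, false for `K = 11(2|c₂| + |c₁|) + 1`.  The capped
forms are NOT touched by this: the obstruction only says the constants must grow with the cap (`2c₂(c₁) + c₁(c₁) ≥ 4c₁/π²`),
which is what the «Caution» announces.

Value = a kernel decision between two typed readings of two skeleton rows (which re-typing is the row of record); NOT a
claim about the printed theorems (print's statement = the capped form, typed, unproved: needs `Pr_M`), NOT summit progress.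
Theorems only (no new definitions, no new facts); imports the sibling `PhaseCellIVThmA34Repaired` only.
-/

namespace Literature.MathematicalPhysics.QuantumFieldTheory.Federbush1986

noncomputable section

open scoped NNReal ENNReal ContDiff Topology Real ComplexConjugate InnerProductSpace
open Set Metric Filter MeasureTheory Complex

namespace PhaseCellIVAppA

local notation "ℝ²" => EuclideanSpace ℝ (Fin 2)
local notation "e₀" => (EuclideanSpace.single (0 : Fin 2) (1 : ℝ) : EuclideanSpace ℝ (Fin 2))
local notation "e₁" => (EuclideanSpace.single (1 : Fin 2) (1 : ℝ) : EuclideanSpace ℝ (Fin 2))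
local notation "Tc" => (Complex.orthonormalBasisOneI.repr.symm : EuclideanSpace ℝ (Fin 2) ≃ₗᵢ[ℝ] ℂ)

/-! The helper lemmas of the obstruction (§§1–6) live in `PhaseCellIVAppA.Obstruction`; the two refutations
themselves are declared in `PhaseCellIVAppA` (§7). -/
namespace Obstruction

/-! ### 1. Plane bookkeeping (`ℝ² = EuclideanSpace ℝ (Fin 2)`, basis `e₀, e₁`, the isometry `Tc : ℝ² ≃ ℂ`) -/

/-- Coordinate `0` of `a e₀ + b e₁` is `a`. [folklore] -/
private theorem lin_apply_zero (a b : ℝ) : (a • e₀ + b • e₁ : ℝ²) 0 = a := by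
  simp

/-- Coordinate `1` of `a e₀ + b e₁` is `b`. [folklore] -/
private theorem lin_apply_one (a b : ℝ) : (a • e₀ + b • e₁ : ℝ²) 1 = b := by
  simp

/-- `‖a e₀ + b e₁‖² = a² + b²`. [folklore] -/
private theorem norm_sq_lin (a b : ℝ) : ‖(a • e₀ + b • e₁ : ℝ²)‖ ^ 2 = a ^ 2 + b ^ 2 := by
  rw [EuclideanSpace.real_norm_sq_eq, Fin.sum_univ_two, lin_apply_zero, lin_apply_one]

/-- `‖e₀‖ = 1`. [folklore] -/
private theorem norm_e₀ : ‖(e₀ : ℝ²)‖ = 1 := by simp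

/-- `Tc : ℝ² ≃ ℂ` is norm-preserving. [folklore] -/
private theorem norm_Tc (x : ℝ²) : ‖Tc x‖ = ‖x‖ := LinearIsometryEquiv.norm_map _ x

/-- The first coordinate is `1`-Lipschitz: `|x₀ − y₀| ≤ ‖x − y‖`. [folklore] -/
private theorem abs_apply_zero_sub_le (x y : ℝ²) : |x 0 - y 0| ≤ ‖x - y‖ := by
  have h := EuclideanSpace.real_norm_sq_eq (x - y)
  rw [Fin.sum_univ_two] at h
  have h0 : (x - y) 0 = x 0 - y 0 := by simp
  have hsq : (x 0 - y 0) ^ 2 ≤ ‖x - y‖ ^ 2 := by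
    rw [h, h0]; nlinarith [sq_nonneg ((x - y) 1)]
  exact abs_le_of_sq_le_sq hsq (norm_nonneg _)

/-! ### 2. The chord `τ ↦ (s sin τ) e₀ + h e₁` -/

/-- Velocity of the trigonometric chord `τ ↦ (s sin τ) e₀ + h e₁` is `(s cos τ) e₀`. [folklore] -/
private theorem chord_hasDerivAt (s h τ : ℝ) :
    HasDerivAt (fun τ : ℝ => ((s * Real.sin τ) • e₀ + h • e₁ : ℝ²)) ((s * Real.cos τ) • e₀) τ := by
  have := ((Real.hasDerivAt_sin τ).const_mul s).smul_const (e₀ : ℝ²)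
  simpa using this.add_const (h • e₁ : ℝ²)

/-- Acceleration of the chord: the velocity `(s cos τ) e₀` has derivative `−(s sin τ) e₀`. [folklore] -/
private theorem chord_speed_hasDerivAt (s τ : ℝ) :
    HasDerivAt (fun τ : ℝ => ((s * Real.cos τ) • e₀ : ℝ²)) ((-(s * Real.sin τ)) • e₀) τ := by
  have := ((Real.hasDerivAt_cos τ).const_mul s).smul_const (e₀ : ℝ²)
  simpa using this

/-- `‖fderiv (fderiv fs) x‖ = ‖D² fs x‖` (operator norms of the curried second derivative). [folklore] -/
private theorem norm_fderiv_fderiv {fs : ℝ² → ℝ²} (x : ℝ²) :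
    ‖fderiv ℝ (fderiv ℝ fs) x‖ = ‖iteratedFDeriv ℝ 2 fs x‖ := by
  rw [← norm_iteratedFDeriv_fderiv, norm_iteratedFDeriv_one]

/-! ### 3. One-variable calculus of unit-modulus curves `φ : ℝ → ℂ` -/

/-- A unit-modulus curve is (real-)orthogonal to its velocity: `⟪φ, φ′⟫ = 0`. [folklore] -/
private theorem inner_eq_zero_of_unit {φ : ℝ → ℂ} {φ' : ℂ} {τ : ℝ} (hφ : HasDerivAt φ φ' τ)
    (hunit : ∀ᶠ t in 𝓝 τ, ‖φ t‖ = 1) : ⟪φ τ, φ'⟫_ℝ = 0 := by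
  have h1 : HasDerivAt (fun t => ⟪φ t, φ t⟫_ℝ) (⟪φ τ, φ'⟫_ℝ + ⟪φ', φ τ⟫_ℝ) τ := hφ.inner ℝ hφ
  have h2 : HasDerivAt (fun t => ⟪φ t, φ t⟫_ℝ) 0 τ := by
    refine (hasDerivAt_const τ (1 : ℝ)).congr_of_eventuallyEq ?_
    filter_upwards [hunit] with t ht
    rw [real_inner_self_eq_norm_sq, ht, one_pow]
  have h3 := h1.unique h2
  rw [real_inner_comm (φ τ) φ'] at h3
  linarith

/-- For a unit-modulus curve, `|φ′|² = −Re(φ̄ φ″) ≤ |φ″|`. [folklore] -/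
private theorem norm_sq_deriv_le_of_unit {φ φ' : ℝ → ℂ} {φ'' : ℂ} {τ : ℝ}
    (hφ : ∀ᶠ t in 𝓝 τ, HasDerivAt φ (φ' t) t) (hφ' : HasDerivAt φ' φ'' τ)
    (hunit : ∀ᶠ t in 𝓝 τ, ‖φ t‖ = 1) : ‖φ' τ‖ ^ 2 ≤ ‖φ''‖ := by
  have h1 : HasDerivAt (fun t => ⟪φ t, φ' t⟫_ℝ) (⟪φ τ, φ''⟫_ℝ + ⟪φ' τ, φ' τ⟫_ℝ) τ :=
    (hφ.self_of_nhds).inner ℝ hφ'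
  have h2 : HasDerivAt (fun t => ⟪φ t, φ' t⟫_ℝ) 0 τ := by
    refine (hasDerivAt_const τ (0 : ℝ)).congr_of_eventuallyEq ?_
    filter_upwards [hφ, hunit.eventually_nhds] with t ht hut
    exact inner_eq_zero_of_unit ht hut
  have h3 := h1.unique h2
  have h4 : ⟪φ' τ, φ' τ⟫_ℝ = ‖φ' τ‖ ^ 2 := real_inner_self_eq_norm_sq _
  have h5 : |⟪φ τ, φ''⟫_ℝ| ≤ ‖φ τ‖ * ‖φ''‖ := abs_real_inner_le_norm _ _
  have h6 : ‖φ τ‖ = 1 := hunit.self_of_nhds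
  rw [h6, one_mul] at h5
  have h7 := neg_abs_le ⟪φ τ, φ''⟫_ℝ
  linarith

/-- The velocity of a unit-modulus curve is `φ′ = φ · iω` with the angular velocity `ω = Im(φ̄ φ′)`. [folklore] -/
private theorem deriv_eq_mul_of_unit {φ : ℝ → ℂ} {φ' : ℂ} {τ : ℝ} (hφ : HasDerivAt φ φ' τ)
    (hunit : ∀ᶠ t in 𝓝 τ, ‖φ t‖ = 1) :
    φ' = φ τ * (((conj (φ τ) * φ') ).im * I) := by
  have h0 := inner_eq_zero_of_unit hφ hunit
  rw [Complex.inner, mul_comm] at h0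
  have h1 : conj (φ τ) * φ' = ((conj (φ τ) * φ')).im * I := by
    apply Complex.ext <;> simp [h0]
  have h2 : φ τ * conj (φ τ) = 1 := by
    rw [Complex.mul_conj, Complex.normSq_eq_norm_sq, hunit.self_of_nhds]; simp
  calc φ' = φ τ * conj (φ τ) * φ' := by rw [h2, one_mul]
    _ = φ τ * (((conj (φ τ) * φ')).im * I) := by rw [mul_assoc, ← h1]

/-- For a unit-modulus curve the speed is the absolute angular velocity: `|φ′| = |Im(φ̄ φ′)|`. [folklore] -/
private theorem norm_deriv_eq_abs_of_unit {φ : ℝ → ℂ} {φ' : ℂ} {τ : ℝ} (hφ : HasDerivAt φ φ' τ)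
    (hunit : ∀ᶠ t in 𝓝 τ, ‖φ t‖ = 1) :
    ‖φ'‖ = |((conj (φ τ) * φ')).im| := by
  have h := deriv_eq_mul_of_unit hφ hunit
  conv_lhs => rw [h]
  rw [norm_mul, hunit.self_of_nhds, one_mul, norm_mul, Complex.norm_I, mul_one,
    Complex.norm_real, Real.norm_eq_abs]

/-- Left endpoint: a function continuous on `[a, b]` and constant `= c` on `(a, b)` equals `c` at `a`. [folklore] -/
private theorem eq_const_left {X : Type*} [TopologicalSpace X] [T2Space X] {R : ℝ → X} {a b : ℝ}
    (hab : a < b) (hR : ContinuousOn R (Icc a b)) {c : X} (hc : ∀ t ∈ Ioo a b, R t = c) :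
    R a = c := by
  haveI := left_nhdsWithin_Ioo_neBot hab
  have h1 : Tendsto R (𝓝[Ioo a b] a) (𝓝 (R a)) :=
    ((hR a ⟨le_rfl, hab.le⟩).tendsto).mono_left (nhdsWithin_mono _ Ioo_subset_Icc_self)
  have h2 : Tendsto R (𝓝[Ioo a b] a) (𝓝 c) :=
    tendsto_const_nhds.congr' (eventually_mem_nhdsWithin.mono fun s hs => (hc s hs).symm)
  exact tendsto_nhds_unique h1 h2

/-- Right endpoint: a function continuous on `[a, b]` and constant `= c` on `(a, b)` equals `c` at `b`. [folklore] -/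
private theorem eq_const_right {X : Type*} [TopologicalSpace X] [T2Space X] {R : ℝ → X} {a b : ℝ}
    (hab : a < b) (hR : ContinuousOn R (Icc a b)) {c : X} (hc : ∀ t ∈ Ioo a b, R t = c) :
    R b = c := by
  haveI := right_nhdsWithin_Ioo_neBot hab
  have h1 : Tendsto R (𝓝[Ioo a b] b) (𝓝 (R b)) :=
    ((hR b ⟨hab.le, le_rfl⟩).tendsto).mono_left (nhdsWithin_mono _ Ioo_subset_Icc_self)
  have h2 : Tendsto R (𝓝[Ioo a b] b) (𝓝 c) :=
    tendsto_const_nhds.congr' (eventually_mem_nhdsWithin.mono fun s hs => (hc s hs).symm)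
  exact tendsto_nhds_unique h1 h2

/-- A function continuous on `[a, b]` and constant on `(a, b)` is constant on `[a, b]`. [folklore] -/
private theorem eq_const_of_Ioo {X : Type*} [TopologicalSpace X] [T2Space X] {R : ℝ → X} {a b : ℝ}
    (hab : a < b) (hR : ContinuousOn R (Icc a b)) {c : X} (hc : ∀ t ∈ Ioo a b, R t = c) :
    ∀ t ∈ Icc a b, R t = c := by
  intro t ht
  rcases eq_or_lt_of_le ht.1 with h | h
  · rw [← h]; exact eq_const_left hab hR hc
  rcases eq_or_lt_of_le ht.2 with h' | h'
  · rw [h']; exact eq_const_right hab hR hc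
  exact hc t ⟨h, h'⟩

/-- **Rotation identity (angle lifting).** A unit-modulus curve, continuous on `[a, b]` and differentiable
inside with integrable angular velocity `ω = Im(φ̄ φ′)`, is `φ(τ) = φ(a) · exp(i ∫ₐ^τ ω)` on `[a, b]`. [folklore] -/
private theorem eq_mul_exp_integral {φ φ' : ℝ → ℂ} {a b : ℝ} (hab : a < b)
    (hderiv : ∀ t ∈ Ioo a b, HasDerivAt φ (φ' t) t) (hunit : ∀ t ∈ Icc a b, ‖φ t‖ = 1)
    (hcont : ContinuousOn φ (Icc a b))
    (hint : IntegrableOn (fun t => ((conj (φ t) * φ' t)).im) (Icc a b))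
    (hangvcont : ContinuousOn (fun t => ((conj (φ t) * φ' t)).im) (Ioo a b)) :
    ∀ τ ∈ Icc a b, φ τ = φ a * exp (I * ∫ t in a..τ, ((conj (φ t) * φ' t)).im) := by
  set angv : ℝ → ℝ := fun t => ((conj (φ t) * φ' t)).im with hangv
  set Θ : ℝ → ℝ := fun τ => ∫ t in a..τ, angv t with hΘ
  have hΘcont : ContinuousOn Θ (Icc a b) := by
    have := intervalIntegral.continuousOn_primitive_interval (μ := volume) (f := angv) (a := a) (b := b)
      (by rwa [uIcc_of_le hab.le])
    rwa [uIcc_of_le hab.le] at this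
  have hΘderiv : ∀ τ ∈ Ioo a b, HasDerivAt Θ (angv τ) τ := by
    intro τ hτ
    refine intervalIntegral.integral_hasDerivAt_right ?_ ?_ ?_
    · exact (hint.mono_set (by
        rw [uIcc_of_le hτ.1.le]; exact Icc_subset_Icc_right hτ.2.le)).intervalIntegrable
    · exact hangvcont.stronglyMeasurableAtFilter isOpen_Ioo τ hτ
    · exact hangvcont.continuousAt (isOpen_Ioo.mem_nhds hτ)
  -- the rotated curve `R = φ · e^{-iΘ}` has zero derivative inside
  set R : ℝ → ℂ := fun t => φ t * exp (-(I * Θ t)) with hR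
  have hunit_nhds : ∀ τ ∈ Ioo a b, ∀ᶠ t in 𝓝 τ, ‖φ t‖ = 1 := fun τ hτ =>
    Filter.eventually_of_mem (isOpen_Ioo.mem_nhds hτ) fun t ht => hunit t (Ioo_subset_Icc_self ht)
  have hRderiv : ∀ τ ∈ Ioo a b, HasDerivAt R 0 τ := by
    intro τ hτ
    have hΘc : HasDerivAt (fun t => -(I * (Θ t : ℂ))) (-(I * angv τ)) τ := by
      have := ((hΘderiv τ hτ).ofReal_comp).const_mul I
      exact this.neg
    have hexp : HasDerivAt (fun t => exp (-(I * (Θ t : ℂ)))) (exp (-(I * Θ τ)) * (-(I * angv τ))) τ :=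
      hΘc.cexp
    have hprod := (hderiv τ hτ).mul hexp
    have hφ' := deriv_eq_mul_of_unit (hderiv τ hτ) (hunit_nhds τ hτ)
    have : φ' τ * exp (-(I * Θ τ)) + φ τ * (exp (-(I * Θ τ)) * (-(I * angv τ))) = 0 := by
      rw [hφ']; ring
    rw [this] at hprod
    exact hprod
  have hRcont : ContinuousOn R (Icc a b) :=
    hcont.mul ((Complex.continuous_ofReal.comp_continuousOn hΘcont).const_smul I |>.neg.cexp)
  obtain ⟨m, hm⟩ : ∃ m, m ∈ Ioo a b := ⟨(a + b) / 2, by constructor <;> linarith⟩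
  have hRconst : ∀ t ∈ Ioo a b, R t = R m := fun t ht =>
    isOpen_Ioo.is_const_of_deriv_eq_zero isPreconnected_Ioo
      (fun s hs => (hRderiv s hs).differentiableAt.differentiableWithinAt)
      (fun s hs => (hRderiv s hs).deriv) ht hm
  have hRall := eq_const_of_Ioo hab hRcont hRconst
  have hRa : R a = φ a := by
    simp [hR, hΘ, intervalIntegral.integral_same]
  intro τ hτ
  have h1 : R τ = φ a := by rw [hRall τ hτ, ← hRall a ⟨le_rfl, hab.le⟩, hRa]
  have h2 : φ τ = R τ * exp (I * Θ τ) := by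
    rw [hR]; simp only
    rw [mul_assoc, ← Complex.exp_add, neg_add_cancel, Complex.exp_zero, mul_one]
  rw [h2, h1]

/-- `exp(ix) = 1` for real `x` forces `x ∈ 2πℤ`. [folklore] -/
private theorem exists_int_of_exp_eq_one {x : ℝ} (h : exp (I * x) = 1) : ∃ n : ℤ, x = 2 * π * n := by
  obtain ⟨n, hn⟩ := Complex.exp_eq_one_iff.mp h
  refine ⟨n, ?_⟩
  have h1 : (x : ℂ) = (2 * π * n : ℝ) := by
    have hI : I ≠ 0 := I_ne_zero
    have : I * (x : ℂ) = I * ((2 * π * n : ℝ) : ℂ) := by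
      rw [hn]; push_cast; ring
    exact mul_left_cancel₀ hI this
  exact_mod_cast h1

/-- If `Θ` is continuous on `[a, b]`, `Θ(a) = 0` and `e^{iΘ}` stays at distance `< 2` from `1` (never reaches `−1`),
then `|Θ| < π` on `[a, b]` (intermediate value theorem). [folklore] -/
private theorem abs_lt_pi_of_ne {Θ : ℝ → ℝ} {a b : ℝ} (hΘ : ContinuousOn Θ (Icc a b))
    (h0 : Θ a = 0) (hne : ∀ t ∈ Icc a b, ‖exp (I * Θ t) - 1‖ < 2) :
    ∀ t ∈ Icc a b, |Θ t| < π := by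
  have key : ∀ s ∈ Icc a b, Θ s ≠ π ∧ Θ s ≠ -π := by
    intro s hs
    constructor
    · intro h
      have := hne s hs
      rw [h, show I * (π : ℂ) = π * I by ring, Complex.exp_pi_mul_I] at this
      norm_num at this
    · intro h
      have := hne s hs
      rw [h, show I * ((-π : ℝ) : ℂ) = -(π * I) by push_cast; ring, Complex.exp_neg,
        Complex.exp_pi_mul_I] at this
      norm_num at this
  intro t ht
  by_contra hcon
  rw [not_lt] at hcon
  rcases le_abs'.mp hcon with h | h
  · -- Θ t ≤ -π
    have hsub : Icc a t ⊆ Icc a b := Icc_subset_Icc_right ht.2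
    have := intermediate_value_Icc' ht.1 (hΘ.mono hsub) (show -π ∈ Icc (Θ t) (Θ a) from
      ⟨h, by rw [h0]; linarith [Real.pi_pos]⟩)
    obtain ⟨s, hs, hs'⟩ := this
    exact (key s (hsub hs)).2 hs'
  · have hsub : Icc a t ⊆ Icc a b := Icc_subset_Icc_right ht.2
    have := intermediate_value_Icc ht.1 (hΘ.mono hsub) (show π ∈ Icc (Θ a) (Θ t) from
      ⟨by rw [h0]; linarith [Real.pi_pos], h⟩)
    obtain ⟨s, hs, hs'⟩ := this
    exact (key s (hsub hs)).1 hs'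

/-- A continuous `2πℤ`-valued function on `[a, b]` vanishing at `b` vanishes at `a` (intermediate value theorem).
[folklore] -/
private theorem eq_zero_of_two_pi_int {g : ℝ → ℝ} {a b : ℝ} (hab : a ≤ b) (hg : ContinuousOn g (Icc a b))
    (hint : ∀ t ∈ Icc a b, ∃ n : ℤ, g t = 2 * π * n) (hb : g b = 0) : g a = 0 := by
  obtain ⟨n, hn⟩ := hint a ⟨le_rfl, hab⟩
  rcases lt_trichotomy n 0 with h | h | h
  · exfalso
    have hn' : (n : ℝ) ≤ -1 := by exact_mod_cast Int.le_sub_one_of_lt h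
    have hga : g a ≤ -π := by rw [hn]; nlinarith [Real.pi_pos]
    obtain ⟨s, hs, hs'⟩ := intermediate_value_Icc hab hg
      (show -π ∈ Icc (g a) (g b) from ⟨hga, by rw [hb]; linarith [Real.pi_pos]⟩)
    obtain ⟨m, hm⟩ := hint s hs
    rw [hs'] at hm
    have : (2 * m + 1 : ℝ) = 0 := by
      have := Real.pi_pos; field_simp at hm ⊢; linarith
    have : (2 * m + 1 : ℤ) = 0 := by exact_mod_cast this
    omega
  · rw [hn, h]; simp
  · exfalso
    have hn' : (1 : ℝ) ≤ n := by exact_mod_cast h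
    have hga : π ≤ g a := by rw [hn]; nlinarith [Real.pi_pos]
    obtain ⟨s, hs, hs'⟩ := intermediate_value_Icc' hab hg
      (show π ∈ Icc (g b) (g a) from ⟨by rw [hb]; linarith [Real.pi_pos], hga⟩)
    obtain ⟨m, hm⟩ := hint s hs
    rw [hs'] at hm
    have : (2 * m - 1 : ℝ) = 0 := by
      have := Real.pi_pos; field_simp at hm ⊢; linarith
    have : (2 * m - 1 : ℤ) = 0 := by exact_mod_cast this
    omega

/-! ### 4. Geometry of the chords `P h τ = (√(1−h²) sin τ) e₀ + h e₁` of the unit disc -/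

/-- `‖P h τ‖² = 1 − (1 − h²) cos² τ`. [folklore] -/
private theorem norm_sq_chordPt {h : ℝ} (hh : h ^ 2 ≤ 1) (τ : ℝ) :
    ‖((√(1 - h ^ 2) * Real.sin τ) • e₀ + h • e₁ : ℝ²)‖ ^ 2 = 1 - (1 - h ^ 2) * Real.cos τ ^ 2 := by
  rw [norm_sq_lin, mul_pow, Real.sq_sqrt (by linarith)]
  nlinarith [Real.sin_sq_add_cos_sq τ]

/-- Chord points lie in the closed unit disc. [folklore] -/
private theorem norm_chordPt_le {h : ℝ} (hh : h ^ 2 ≤ 1) (τ : ℝ) :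
    ‖((√(1 - h ^ 2) * Real.sin τ) • e₀ + h • e₁ : ℝ²)‖ ≤ 1 := by
  have h1 := norm_sq_chordPt hh τ
  have h2 : 0 ≤ (1 - h ^ 2) * Real.cos τ ^ 2 := mul_nonneg (by linarith) (sq_nonneg _)
  nlinarith [norm_nonneg ((√(1 - h ^ 2) * Real.sin τ) • e₀ + h • e₁ : ℝ²)]

/-- Open chords (`h² < 1`, `|τ| < π/2`) lie in the open unit disc. [folklore] -/
private theorem norm_chordPt_lt {h : ℝ} (hh : h ^ 2 < 1) {τ : ℝ} (hτ : τ ∈ Ioo (-(π / 2)) (π / 2)) :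
    ‖((√(1 - h ^ 2) * Real.sin τ) • e₀ + h • e₁ : ℝ²)‖ < 1 := by
  have h1 := norm_sq_chordPt hh.le τ
  have h2 : 0 < (1 - h ^ 2) * Real.cos τ ^ 2 :=
    mul_pos (by linarith) (pow_pos (Real.cos_pos_of_mem_Ioo hτ) 2)
  nlinarith [norm_nonneg ((√(1 - h ^ 2) * Real.sin τ) • e₀ + h • e₁ : ℝ²)]

/-- The squared trigonometric speed is controlled by the distance to the boundary circle:
`(1 − h²) cos² τ = 1 − ‖P‖² ≤ 2 (1 − ‖P‖)`. [folklore] -/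
private theorem defect_le_two_mul {h : ℝ} (hh : h ^ 2 ≤ 1) (τ : ℝ) :
    (1 - h ^ 2) * Real.cos τ ^ 2 ≤ 2 * (1 - ‖((√(1 - h ^ 2) * Real.sin τ) • e₀ + h • e₁ : ℝ²)‖) := by
  have h1 := norm_sq_chordPt hh τ
  have h2 := norm_chordPt_le hh τ
  nlinarith [norm_nonneg ((√(1 - h ^ 2) * Real.sin τ) • e₀ + h • e₁ : ℝ²)]

/-- Distance of a chord point to the pole `e₁`: `‖P h τ − e₁‖² ≤ 2(1 − h)`. [folklore] -/
private theorem norm_sq_chordPt_sub_pole {h : ℝ} (hh : h ^ 2 ≤ 1) (τ : ℝ) :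
    ‖((√(1 - h ^ 2) * Real.sin τ) • e₀ + h • e₁ : ℝ²) - e₁‖ ^ 2 ≤ 2 * (1 - h) := by
  have : ((√(1 - h ^ 2) * Real.sin τ) • e₀ + h • e₁ : ℝ²) - e₁
      = (√(1 - h ^ 2) * Real.sin τ) • e₀ + (h - 1) • e₁ := by
    rw [sub_smul, one_smul]; abel
  rw [this, norm_sq_lin, mul_pow, Real.sq_sqrt (by linarith)]
  nlinarith [Real.sin_sq_le_one τ, sq_nonneg (1 - h)]

/-! ### 5. The chord obstruction -/

/-- **Chord obstruction** (the analytic core of both refutations).  `fs : ℝ² → ℝ²` is continuous on `D`,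
`C²` on the open set `U`; the closed chords `τ ↦ P h τ = (√(1−h²) sin τ) e₀ + h e₁`, `h ∈ [h₀, 1]`, `|τ| ≤ π/2`,
lie in `D`, the open ones (`h < 1`, `|τ| < π/2`) in `U`; `fs` has unit norm on the chords and the boundary values
`e^{± iK√(1−h²)}` (read in `ℂ`) at the chord ends; `‖D fs‖ ≤ C₁` and `‖D² fs‖·(1 − ‖P‖) ≤ C₂` on the open chords.
Then `2K√(1 − h₀²) ≤ π√(2C₂ + C₁)`: the angle accumulated along the chord at height `h` differs from `2K√(1−h²)`
by a continuous `2πℤ`-valued function of `h` that vanishes near the pole `h = 1`, hence at `h₀`, while the angular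
speed along every chord is at most `√(2C₂ + C₁)`.  (Our argument; used below with the constants of the uncapped
(A.26)/(A.36).) [cite: Federbush1988PhaseCellIV, Theorem A.3 (A.26) p. 342, Theorem A.4 (A.36) p. 343; «Caution» p. 339] -/
private theorem chord_obstruction {U D : Set ℝ²} {fs : ℝ² → ℝ²} {h₀ K C₁ C₂ : ℝ}
    (S : ℝ → ℝ) (hS : ∀ h, S h = √(1 - h ^ 2)) (P : ℝ → ℝ → ℝ²)
    (hP : ∀ h τ, P h τ = (S h * Real.sin τ) • e₀ + h • e₁)
    (hh₀ : 0 ≤ h₀) (hh₀1 : h₀ < 1) (hK : 0 ≤ K) (hC₁ : 0 ≤ C₁)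
    (hU : IsOpen U) (hfs : ContDiffOn ℝ 2 fs U)
    (hPU : ∀ h ∈ Ico h₀ 1, ∀ τ ∈ Ioo (-(π / 2)) (π / 2), P h τ ∈ U)
    (hD : ContinuousOn fs D) (hPD : ∀ h ∈ Icc h₀ 1, ∀ τ ∈ Icc (-(π / 2)) (π / 2), P h τ ∈ D)
    (hunit : ∀ h ∈ Icc h₀ 1, ∀ τ ∈ Icc (-(π / 2)) (π / 2), ‖fs (P h τ)‖ = 1)
    (hbd : ∀ h ∈ Icc h₀ 1, ∀ τ : ℝ, (τ = -(π / 2) ∨ τ = π / 2) →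
      Tc (fs (P h τ)) = exp (I * (K * (S h * Real.sin τ))))
    (hb1 : ∀ h ∈ Ico h₀ 1, ∀ τ ∈ Ioo (-(π / 2)) (π / 2), ‖fderiv ℝ fs (P h τ)‖ ≤ C₁)
    (hb2 : ∀ h ∈ Ico h₀ 1, ∀ τ ∈ Ioo (-(π / 2)) (π / 2),
      ‖iteratedFDeriv ℝ 2 fs (P h τ)‖ * (1 - ‖P h τ‖) ≤ C₂) :
    2 * K * S h₀ ≤ π * √(2 * C₂ + C₁) := by
  have hπ2 : -(π / 2) < π / 2 := by linarith [Real.pi_pos]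
  -- the objects
  set φ : ℝ → ℝ → ℂ := fun h τ => Tc (fs (P h τ)) with hφ
  set φ' : ℝ → ℝ → ℂ := fun h τ => Tc (fderiv ℝ fs (P h τ) ((S h * Real.cos τ) • e₀)) with hφ'
  set angv : ℝ → ℝ → ℝ := fun h τ => (conj (φ h τ) * φ' h τ).im with hangv
  set A : ℝ → ℝ := fun h => ∫ t in (-(π / 2))..(π / 2), angv h t with hA
  set Ω : ℝ := √(2 * C₂ + C₁) with hΩ
  have hΩ0 : 0 ≤ Ω := Real.sqrt_nonneg _
  -- elementary facts about `S`
  have hS0 : ∀ h, 0 ≤ S h := fun h => by rw [hS]; exact Real.sqrt_nonneg _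
  have hSsq : ∀ h, h ^ 2 ≤ 1 → S h ^ 2 = 1 - h ^ 2 := fun h hh => by
    rw [hS, Real.sq_sqrt (by linarith)]
  have hS1 : ∀ h, h ^ 2 ≤ 1 → S h ≤ 1 := fun h hh => by
    rw [hS]
    calc √(1 - h ^ 2) ≤ √1 := Real.sqrt_le_sqrt (by nlinarith)
      _ = 1 := Real.sqrt_one
  have hScont : Continuous S := by
    have : S = fun h => √(1 - h ^ 2) := funext hS
    rw [this]; fun_prop
  have hIco_sq : ∀ h ∈ Ico h₀ 1, h ^ 2 < 1 := fun h hh => by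
    have : 0 ≤ h := hh₀.trans hh.1
    nlinarith [hh.2]
  have hIcc_sq : ∀ h ∈ Icc h₀ 1, h ^ 2 ≤ 1 := fun h hh => by
    have : 0 ≤ h := hh₀.trans hh.1
    nlinarith [hh.2]
  -- derivative of the chord
  have hPderiv : ∀ h τ, HasDerivAt (P h) ((S h * Real.cos τ) • e₀) τ := fun h τ =>
    (chord_hasDerivAt (S h) h τ).congr_of_eventuallyEq (Eventually.of_forall (hP h))
  have hPcont : ∀ h, Continuous (P h) := fun h =>
    continuous_iff_continuousAt.mpr fun τ => (hPderiv h τ).continuousAt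
  -- Step 1: derivatives of `φ h` along open chords
  have hder1 : ∀ h ∈ Ico h₀ 1, ∀ τ ∈ Ioo (-(π / 2)) (π / 2), HasDerivAt (φ h) (φ' h τ) τ := by
    intro h hh τ hτ
    have hd : DifferentiableAt ℝ fs (P h τ) :=
      (hfs.differentiableOn (by norm_num)).differentiableAt (hU.mem_nhds (hPU h hh τ hτ))
    have h1 := hd.hasFDerivAt.comp_hasDerivAt τ (hPderiv h τ)
    have h2 := (Tc : ℝ² ≃ₗᵢ[ℝ] ℂ).toContinuousLinearEquiv.toContinuousLinearMap.hasFDerivAt.comp_hasDerivAt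
      τ h1
    show HasDerivAt (fun τ => Tc (fs (P h τ))) (Tc (fderiv ℝ fs (P h τ) ((S h * Real.cos τ) • e₀))) τ
    simpa [Function.comp_def] using h2
  have hder2 : ∀ h ∈ Ico h₀ 1, ∀ τ ∈ Ioo (-(π / 2)) (π / 2), HasDerivAt (φ' h)
      (Tc (fderiv ℝ (fderiv ℝ fs) (P h τ) ((S h * Real.cos τ) • e₀) ((S h * Real.cos τ) • e₀)
        + fderiv ℝ fs (P h τ) ((-(S h * Real.sin τ)) • e₀))) τ := by
    intro h hh τ hτ
    have hF : ContDiffOn ℝ 1 (fderiv ℝ fs) U := hfs.fderiv_of_isOpen hU (by norm_num)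
    have hd : DifferentiableAt ℝ (fderiv ℝ fs) (P h τ) :=
      (hF.differentiableOn (by norm_num)).differentiableAt (hU.mem_nhds (hPU h hh τ hτ))
    have h1 : HasDerivAt (fun τ : ℝ => fderiv ℝ fs (P h τ))
        (fderiv ℝ (fderiv ℝ fs) (P h τ) ((S h * Real.cos τ) • e₀)) τ := by
      have := hd.hasFDerivAt.comp_hasDerivAt τ (hPderiv h τ)
      simpa [Function.comp_def] using this
    have h2 := h1.clm_apply (chord_speed_hasDerivAt (S h) τ)
    have h3 := (Tc : ℝ² ≃ₗᵢ[ℝ] ℂ).toContinuousLinearEquiv.toContinuousLinearMap.hasFDerivAt.comp_hasDerivAt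
      τ h2
    show HasDerivAt (fun τ => Tc (fderiv ℝ fs (P h τ) ((S h * Real.cos τ) • e₀))) _ τ
    simpa [Function.comp_def] using h3
  -- unit modulus of `φ h` on closed chords
  have hφunit : ∀ h ∈ Icc h₀ 1, ∀ τ ∈ Icc (-(π / 2)) (π / 2), ‖φ h τ‖ = 1 := fun h hh τ hτ => by
    simp only [hφ, norm_Tc]; exact hunit h hh τ hτ
  have hφunit_nhds : ∀ h ∈ Ico h₀ 1, ∀ τ ∈ Ioo (-(π / 2)) (π / 2), ∀ᶠ t in 𝓝 τ, ‖φ h t‖ = 1 :=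
    fun h hh τ hτ => Filter.eventually_of_mem (isOpen_Ioo.mem_nhds hτ)
      fun t ht => hφunit h (Ico_subset_Icc_self hh) t (Ioo_subset_Icc_self ht)
  -- Step 2: `|angv| ≤ Ω` on the chords
  have hφ'bound : ∀ h ∈ Ico h₀ 1, ∀ τ ∈ Ioo (-(π / 2)) (π / 2), ‖φ' h τ‖ ≤ Ω := by
    intro h hh τ hτ
    have hsq : ‖φ' h τ‖ ^ 2 ≤ 2 * C₂ + C₁ := by
      have hev : ∀ᶠ t in 𝓝 τ, HasDerivAt (φ h) (φ' h t) t :=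
        Filter.eventually_of_mem (isOpen_Ioo.mem_nhds hτ) fun t ht => hder1 h hh t ht
      have h1 := norm_sq_deriv_le_of_unit hev (hder2 h hh τ hτ) (hφunit_nhds h hh τ hτ)
      refine h1.trans ?_
      rw [norm_Tc]
      have hv : ‖((S h * Real.cos τ) • e₀ : ℝ²)‖ ^ 2 = (1 - h ^ 2) * Real.cos τ ^ 2 := by
        rw [norm_smul, norm_e₀, mul_one, Real.norm_eq_abs, sq_abs, mul_pow, hSsq h (hIco_sq h hh).le]
      have hv' : ‖((-(S h * Real.sin τ)) • e₀ : ℝ²)‖ ≤ 1 := by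
        rw [norm_smul, norm_e₀, mul_one, Real.norm_eq_abs, abs_neg, abs_mul,
          abs_of_nonneg (hS0 h)]
        calc S h * |Real.sin τ| ≤ 1 * 1 := by
              gcongr
              · exact hS1 h (hIco_sq h hh).le
              · exact Real.abs_sin_le_one τ
          _ = 1 := one_mul 1
      have hdefect := defect_le_two_mul (hIco_sq h hh).le τ
      rw [← hS h, ← hP h τ] at hdefect
      have hD2 := hb2 h hh τ hτ
      have hD1 := hb1 h hh τ hτ
      have hnn2 : 0 ≤ ‖iteratedFDeriv ℝ 2 fs (P h τ)‖ := norm_nonneg _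
      calc ‖fderiv ℝ (fderiv ℝ fs) (P h τ) ((S h * Real.cos τ) • e₀) ((S h * Real.cos τ) • e₀)
              + fderiv ℝ fs (P h τ) ((-(S h * Real.sin τ)) • e₀)‖
          ≤ ‖fderiv ℝ (fderiv ℝ fs) (P h τ) ((S h * Real.cos τ) • e₀) ((S h * Real.cos τ) • e₀)‖
              + ‖fderiv ℝ fs (P h τ) ((-(S h * Real.sin τ)) • e₀)‖ := norm_add_le _ _
        _ ≤ ‖fderiv ℝ (fderiv ℝ fs) (P h τ)‖ * ‖((S h * Real.cos τ) • e₀ : ℝ²)‖ * ‖((S h * Real.cos τ) • e₀ : ℝ²)‖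
              + ‖fderiv ℝ fs (P h τ)‖ * ‖((-(S h * Real.sin τ)) • e₀ : ℝ²)‖ :=
            add_le_add
              ((ContinuousLinearMap.le_opNorm _ _).trans
                (mul_le_mul_of_nonneg_right (ContinuousLinearMap.le_opNorm _ _) (norm_nonneg _)))
              (ContinuousLinearMap.le_opNorm _ _)
        _ = ‖iteratedFDeriv ℝ 2 fs (P h τ)‖ * ((1 - h ^ 2) * Real.cos τ ^ 2)
              + ‖fderiv ℝ fs (P h τ)‖ * ‖((-(S h * Real.sin τ)) • e₀ : ℝ²)‖ := by
            rw [norm_fderiv_fderiv, mul_assoc, ← sq, hv]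
        _ ≤ ‖iteratedFDeriv ℝ 2 fs (P h τ)‖ * (2 * (1 - ‖P h τ‖)) + C₁ * 1 :=
            add_le_add (mul_le_mul_of_nonneg_left hdefect hnn2) (mul_le_mul hD1 hv' (norm_nonneg _) hC₁)
        _ = 2 * (‖iteratedFDeriv ℝ 2 fs (P h τ)‖ * (1 - ‖P h τ‖)) + C₁ := by ring
        _ ≤ 2 * C₂ + C₁ := by linarith
    calc ‖φ' h τ‖ = √(‖φ' h τ‖ ^ 2) := by rw [Real.sqrt_sq (norm_nonneg _)]
      _ ≤ Ω := Real.sqrt_le_sqrt hsq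
  -- `φ' h (±π/2) = 0`, hence `angv h (±π/2) = 0`
  have hφ'end : ∀ h τ, (τ = -(π / 2) ∨ τ = π / 2) → φ' h τ = 0 := by
    intro h τ hτ
    have hc : Real.cos τ = 0 := by
      rcases hτ with rfl | rfl
      · rw [Real.cos_neg, Real.cos_pi_div_two]
      · exact Real.cos_pi_div_two
    have hv0 : ((S h * Real.cos τ) • e₀ : ℝ²) = 0 := by rw [hc, mul_zero, zero_smul]
    show Tc (fderiv ℝ fs (P h τ) ((S h * Real.cos τ) • e₀)) = 0
    rw [hv0, map_zero, map_zero]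
  have hangv_abs : ∀ h ∈ Ico h₀ 1, ∀ τ ∈ Icc (-(π / 2)) (π / 2), |angv h τ| ≤ Ω := by
    intro h hh τ hτ
    rcases eq_or_lt_of_le hτ.1 with h1 | h1
    · have := hφ'end h τ (Or.inl h1.symm)
      simp [hangv, this, hΩ0]
    rcases eq_or_lt_of_le hτ.2 with h2 | h2
    · have := hφ'end h τ (Or.inr h2)
      simp [hangv, this, hΩ0]
    rw [← norm_deriv_eq_abs_of_unit (hder1 h hh τ ⟨h1, h2⟩) (hφunit_nhds h hh τ ⟨h1, h2⟩)]
    exact hφ'bound h hh τ ⟨h1, h2⟩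
  -- Step 3: continuity / integrability along a fixed chord
  have hfderiv_cont : ContinuousOn (fderiv ℝ fs) U := hfs.continuousOn_fderiv_of_isOpen hU (by norm_num)
  have hφcont : ∀ h ∈ Icc h₀ 1, ContinuousOn (φ h) (Icc (-(π / 2)) (π / 2)) := by
    intro h hh
    have h1 : ContinuousOn (fun τ => fs (P h τ)) (Icc (-(π / 2)) (π / 2)) :=
      hD.comp (hPcont h).continuousOn fun τ hτ => hPD h hh τ hτ
    exact (Tc : ℝ² ≃ₗᵢ[ℝ] ℂ).continuous.comp_continuousOn h1
  have hφ'cont : ∀ h ∈ Ico h₀ 1, ContinuousOn (φ' h) (Ioo (-(π / 2)) (π / 2)) := by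
    intro h hh
    have h1 : ContinuousOn (fun τ => fderiv ℝ fs (P h τ)) (Ioo (-(π / 2)) (π / 2)) :=
      hfderiv_cont.comp (hPcont h).continuousOn fun τ hτ => hPU h hh τ hτ
    have h2 : ContinuousOn (fun τ : ℝ => ((S h * Real.cos τ) • e₀ : ℝ²)) (Ioo (-(π / 2)) (π / 2)) := by
      fun_prop
    exact (Tc : ℝ² ≃ₗᵢ[ℝ] ℂ).continuous.comp_continuousOn (h1.clm_apply h2)
  have hangv_cont : ∀ h ∈ Ico h₀ 1, ContinuousOn (angv h) (Ioo (-(π / 2)) (π / 2)) := by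
    intro h hh
    have h1 := ((Complex.continuous_conj.comp_continuousOn
      ((hφcont h (Ico_subset_Icc_self hh)).mono Ioo_subset_Icc_self)).mul (hφ'cont h hh))
    exact Complex.continuous_im.comp_continuousOn h1
  have hangv_int : ∀ h ∈ Ico h₀ 1, IntegrableOn (angv h) (Icc (-(π / 2)) (π / 2)) := by
    intro h hh
    rw [integrableOn_Icc_iff_integrableOn_Ioo]
    refine Integrable.mono' (integrable_const Ω)
      ((hangv_cont h hh).aestronglyMeasurable measurableSet_Ioo) ?_
    rw [ae_restrict_iff' measurableSet_Ioo]
    exact Eventually.of_forall fun t ht => by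
      rw [Real.norm_eq_abs]; exact hangv_abs h hh t (Ioo_subset_Icc_self ht)
  -- Step 4: rotation identity and the winding relation `A h − 2 K S h ∈ 2πℤ`
  have hrot : ∀ h ∈ Ico h₀ 1, ∀ τ ∈ Icc (-(π / 2)) (π / 2),
      φ h τ = φ h (-(π / 2)) * exp (I * ∫ t in (-(π / 2))..τ, angv h t) := by
    intro h hh
    exact eq_mul_exp_integral hπ2 (hder1 h hh) (hφunit h (Ico_subset_Icc_self hh))
      (hφcont h (Ico_subset_Icc_self hh)) (hangv_int h hh) (hangv_cont h hh)
  have hwind : ∀ h ∈ Ico h₀ 1, ∃ n : ℤ, A h - 2 * K * S h = 2 * π * n := by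
    intro h hh
    have h1 := hrot h hh (π / 2) ⟨hπ2.le, le_rfl⟩
    have hbplus : φ h (π / 2) = exp (I * (K * S h)) := by
      have := hbd h (Ico_subset_Icc_self hh) (π / 2) (Or.inr rfl)
      rw [Real.sin_pi_div_two] at this
      show Tc (fs (P h (π / 2))) = _
      rw [this]; congr 1; push_cast; ring
    have hbminus : φ h (-(π / 2)) = exp (-(I * (K * S h))) := by
      have := hbd h (Ico_subset_Icc_self hh) (-(π / 2)) (Or.inl rfl)
      rw [Real.sin_neg, Real.sin_pi_div_two] at this
      show Tc (fs (P h (-(π / 2)))) = _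
      rw [this]; congr 1; push_cast; ring
    rw [hbplus, hbminus] at h1
    apply exists_int_of_exp_eq_one
    have h2 : exp (I * ((A h - 2 * K * S h : ℝ) : ℂ))
        = exp (I * (A h : ℂ)) * exp (-(I * (K * S h))) * exp (-(I * (K * S h))) := by
      rw [← Complex.exp_add, ← Complex.exp_add]; congr 1; push_cast; ring
    rw [h2]
    have h3 : exp (I * (A h : ℂ)) * exp (-(I * (K * S h))) = exp (I * (K * S h)) := by
      rw [mul_comm]; exact h1.symm
    rw [h3, ← Complex.exp_add]; simp
  -- Step 5: continuity of `A` on `[h₀, 1)`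
  have hAcont : ContinuousOn A (Ico h₀ 1) := by
    intro h₁ hh₁
    have hmem : ∀ᶠ h in 𝓝[Ico h₀ 1] h₁, h ∈ Ico h₀ 1 := eventually_mem_nhdsWithin
    show ContinuousWithinAt (fun x => ∫ t in (-(π / 2))..(π / 2), angv x t) (Ico h₀ 1) h₁
    refine intervalIntegral.continuousWithinAt_of_dominated_interval
      (bound := fun _ => Ω) ?_ ?_ ?_ ?_
    · filter_upwards [hmem] with h hh
      rw [uIoc_of_le hπ2.le, ← Measure.restrict_congr_set Ioo_ae_eq_Ioc]
      exact (hangv_cont h hh).aestronglyMeasurable measurableSet_Ioo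
    · filter_upwards [hmem] with h hh
      refine Eventually.of_forall fun t ht => ?_
      rw [uIoc_of_le hπ2.le] at ht
      rw [Real.norm_eq_abs]
      exact hangv_abs h hh t (Ioc_subset_Icc_self ht)
    · exact intervalIntegrable_const
    · refine Eventually.of_forall fun t ht => ?_
      rw [uIoc_of_le hπ2.le] at ht
      rcases eq_or_lt_of_le ht.2 with h2 | h2
      · -- `t = π/2`: `angv h t = 0` for every `h`
        have : (fun h => angv h t) = fun _ => 0 := by
          funext h
          have := hφ'end h t (Or.inr h2)
          simp [hangv, this]
        rw [this]; exact continuousWithinAt_const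
      have htI : t ∈ Ioo (-(π / 2)) (π / 2) := ⟨ht.1, h2⟩
      -- `h ↦ angv h t` is continuous at `h₁`
      have hPh : Continuous fun h => P h t := by
        have : (fun h => P h t) = fun h => (S h * Real.sin t) • e₀ + h • e₁ := funext fun h => hP h t
        rw [this]; fun_prop
      have hx : P h₁ t ∈ U := hPU h₁ hh₁ t htI
      have c1 : ContinuousAt (fun h => fs (P h t)) h₁ :=
        ContinuousAt.comp (f := fun h => P h t) (hfs.continuousOn.continuousAt (hU.mem_nhds hx))
          hPh.continuousAt
      have c2 : ContinuousAt (fun h => fderiv ℝ fs (P h t)) h₁ :=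
        ContinuousAt.comp (f := fun h => P h t) (hfderiv_cont.continuousAt (hU.mem_nhds hx))
          hPh.continuousAt
      have c3 : ContinuousAt (fun h => ((S h * Real.cos t) • e₀ : ℝ²)) h₁ := by fun_prop
      have c4 : ContinuousAt (fun h => φ' h t) h₁ := by
        simp only [hφ']
        exact (Tc : ℝ² ≃ₗᵢ[ℝ] ℂ).continuous.continuousAt.comp (c2.clm_apply c3)
      have c5 : ContinuousAt (fun h => φ h t) h₁ := by
        simp only [hφ]
        exact (Tc : ℝ² ≃ₗᵢ[ℝ] ℂ).continuous.continuousAt.comp c1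
      have c6 : ContinuousAt (fun h => angv h t) h₁ := by
        simp only [hangv]
        exact Complex.continuous_im.continuousAt.comp
          ((Complex.continuous_conj.continuousAt.comp c5).mul c4)
      exact c6.continuousWithinAt
  -- Step 6: smallness near the pole `e₁`
  have h1mem : (1 : ℝ) ∈ Icc h₀ 1 := ⟨hh₀1.le, le_rfl⟩
  have hP1 : ∀ τ, P 1 τ = e₁ := fun τ => by
    rw [hP, hS]; simp
  have hpole_val : Tc (fs e₁) = 1 := by
    have := hbd 1 h1mem (π / 2) (Or.inr rfl)
    rw [hP1, hS] at this
    rw [this]; simp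
  have he₁D : (e₁ : ℝ²) ∈ D := by
    have := hPD 1 h1mem 0 ⟨by linarith [Real.pi_pos], by linarith [Real.pi_pos]⟩
    rwa [hP1] at this
  obtain ⟨δ, hδ, hδclose⟩ : ∃ δ > 0, ∀ x ∈ D, dist x e₁ < δ → dist (fs x) (fs e₁) < 1 :=
    (Metric.continuousWithinAt_iff.mp (hD e₁ he₁D)) 1 one_pos
  -- choice of the height `h₁`
  set η : ℝ := min (δ ^ 2 / 4) (1 / (8 * K ^ 2 + 1)) with hη
  have hη0 : 0 < η := lt_min (by positivity) (by positivity)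
  have hηδ : η ≤ δ ^ 2 / 4 := min_le_left _ _
  have hηK : η ≤ 1 / (8 * K ^ 2 + 1) := min_le_right _ _
  set h₁ : ℝ := max h₀ (1 - η) with hh₁def
  have hh₁ : h₁ ∈ Ico h₀ 1 := ⟨le_max_left _ _, max_lt hh₀1 (by linarith)⟩
  have hh₁' : 1 - h₁ ≤ η := by have := le_max_right h₀ (1 - η); linarith
  have hh₁sq : 1 - h₁ ^ 2 ≤ 2 * η := by
    have : 0 ≤ h₁ := hh₀.trans hh₁.1
    nlinarith [hh₁.2, sq_nonneg (1 - h₁)]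
  -- (a) the chord at height `h₁` is mapped within distance `1` of `fs e₁`
  have hclose : ∀ τ ∈ Icc (-(π / 2)) (π / 2), ‖φ h₁ τ - 1‖ < 1 := by
    intro τ hτ
    have hx : P h₁ τ ∈ D := hPD h₁ (Ico_subset_Icc_self hh₁) τ hτ
    have hdist : dist (P h₁ τ) e₁ < δ := by
      rw [dist_eq_norm]
      have hsq : ‖P h₁ τ - e₁‖ ^ 2 < δ ^ 2 := by
        have := norm_sq_chordPt_sub_pole (hIcc_sq h₁ (Ico_subset_Icc_self hh₁)) τ
        rw [← hS, ← hP] at this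
        nlinarith
      exact lt_of_pow_lt_pow_left₀ 2 hδ.le hsq
    have := hδclose (P h₁ τ) hx hdist
    rw [dist_eq_norm] at this
    have e : φ h₁ τ - 1 = Tc (fs (P h₁ τ) - fs e₁) := by simp only [hφ, map_sub, hpole_val]
    rw [e, norm_Tc]; exact this
  -- (b) hence `|A h₁| < π`
  have hA₁ : |A h₁| < π := by
    have hΘcont : ContinuousOn (fun τ => ∫ t in (-(π / 2))..τ, angv h₁ t) (Icc (-(π / 2)) (π / 2)) := by
      have := intervalIntegral.continuousOn_primitive_interval (μ := volume) (f := angv h₁)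
        (a := -(π / 2)) (b := π / 2) (by rw [uIcc_of_le hπ2.le]; exact hangv_int h₁ hh₁)
      rwa [uIcc_of_le hπ2.le] at this
    have hne : ∀ τ ∈ Icc (-(π / 2)) (π / 2),
        ‖exp (I * ((∫ t in (-(π / 2))..τ, angv h₁ t : ℝ) : ℂ)) - 1‖ < 2 := by
      intro τ hτ
      have hr := hrot h₁ hh₁ τ hτ
      have hu : ‖φ h₁ (-(π / 2))‖ = 1 := hφunit h₁ (Ico_subset_Icc_self hh₁) _ ⟨le_rfl, hπ2.le⟩
      have : ‖exp (I * ((∫ t in (-(π / 2))..τ, angv h₁ t : ℝ) : ℂ)) - 1‖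
          = ‖φ h₁ τ - φ h₁ (-(π / 2))‖ := by
        rw [hr, ← mul_sub_one, norm_mul, hu, one_mul]
      rw [this]
      calc ‖φ h₁ τ - φ h₁ (-(π / 2))‖ = ‖(φ h₁ τ - 1) - (φ h₁ (-(π / 2)) - 1)‖ := by
              congr 1; ring
        _ ≤ ‖φ h₁ τ - 1‖ + ‖φ h₁ (-(π / 2)) - 1‖ := norm_sub_le _ _
        _ < 1 + 1 := add_lt_add (hclose τ hτ) (hclose _ ⟨le_rfl, hπ2.le⟩)
        _ = 2 := by norm_num
    have := abs_lt_pi_of_ne hΘcont (by simp [intervalIntegral.integral_same]) hne (π / 2) ⟨hπ2.le, le_rfl⟩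
    simpa [hA] using this
  -- (c) and `0 ≤ 2 K S h₁ < π`, so the winding integer at `h₁` vanishes
  have h2KS : 2 * K * S h₁ < π := by
    have hsq : (2 * K * S h₁) ^ 2 < π ^ 2 := by
      have e1 : (2 * K * S h₁) ^ 2 = 4 * K ^ 2 * (1 - h₁ ^ 2) := by
        rw [mul_pow, mul_pow, hSsq h₁ (hIcc_sq h₁ (Ico_subset_Icc_self hh₁))]; ring
      rw [e1]
      have e2 : 4 * K ^ 2 * (1 - h₁ ^ 2) ≤ 8 * K ^ 2 * η := by nlinarith [sq_nonneg K]
      have e3 : 8 * K ^ 2 * η < 1 := by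
        have h8 : 0 < 8 * K ^ 2 + 1 := by positivity
        calc 8 * K ^ 2 * η ≤ 8 * K ^ 2 * (1 / (8 * K ^ 2 + 1)) := by gcongr
          _ = 8 * K ^ 2 / (8 * K ^ 2 + 1) := by ring
          _ < 1 := by rw [div_lt_one h8]; linarith
      nlinarith [Real.pi_gt_three]
    exact lt_of_pow_lt_pow_left₀ 2 Real.pi_pos.le hsq
  have h2KS0 : 0 ≤ 2 * K * S h₁ := mul_nonneg (mul_nonneg (by norm_num) hK) (hS0 h₁)
  have hAh₁ : A h₁ - 2 * K * S h₁ = 0 := by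
    obtain ⟨n, hn⟩ := hwind h₁ hh₁
    have hlt : |(2 * π * n : ℝ)| < 2 * π := by
      rw [← hn]
      have := abs_lt.mp hA₁
      rw [abs_lt]; constructor <;> linarith
    have : |(n : ℝ)| < 1 := by
      rw [abs_mul, abs_of_pos (by positivity : (0 : ℝ) < 2 * π)] at hlt
      nlinarith [Real.pi_pos, abs_nonneg (n : ℝ)]
    have hn0 : n = 0 := by
      have : |n| < 1 := by exact_mod_cast this
      exact Int.abs_lt_one_iff.mp this
    rw [hn, hn0]; simp
  -- Step 7: the winding integer is constant on `[h₀, h₁]`, hence `A h₀ = 2 K S h₀`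
  have hAh₀ : A h₀ - 2 * K * S h₀ = 0 := by
    refine eq_zero_of_two_pi_int hh₁.1 (g := fun h => A h - 2 * K * S h) ?_ ?_ hAh₁
    · have hsub : Icc h₀ h₁ ⊆ Ico h₀ 1 := fun h hh => ⟨hh.1, hh.2.trans_lt hh₁.2⟩
      exact (hAcont.mono hsub).sub ((continuous_const.mul hScont).continuousOn)
    · intro h hh
      exact hwind h ⟨hh.1, hh.2.trans_lt hh₁.2⟩
  -- Step 8: `|A h₀| ≤ π Ω`
  have hAbound : |A h₀| ≤ Ω * π := by
    have hh₀mem : h₀ ∈ Ico h₀ 1 := ⟨le_rfl, hh₀1⟩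
    have := intervalIntegral.norm_integral_le_of_norm_le_const (a := -(π / 2)) (b := π / 2)
      (f := angv h₀) (C := Ω) fun t ht => by
        rw [uIoc_of_le hπ2.le] at ht
        rw [Real.norm_eq_abs]; exact hangv_abs h₀ hh₀mem t (Ioc_subset_Icc_self ht)
    rw [Real.norm_eq_abs] at this
    have hlen : |π / 2 - -(π / 2)| = π := by
      rw [sub_neg_eq_add, add_halves, abs_of_pos Real.pi_pos]
    rw [hlen] at this
    exact this
  have := le_abs_self (A h₀)
  nlinarith

/-! ### 6. The datum `x ↦ e^{iKx₀}` (values in `S¹ ⊂ ℝ²`, Lipschitz constant `K`) -/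

/-- `‖e^{iKa}‖ = 1` for real `K`, `a`. [folklore] -/
private theorem norm_exp_I_mul_mul (K a : ℝ) : ‖exp (I * (K * a))‖ = 1 := by
  rw [← Complex.ofReal_mul]; exact Complex.norm_exp_I_mul_ofReal _

/-- The datum `x ↦ Tc⁻¹ e^{iKx₀}` takes values in the unit circle. [folklore] -/
private theorem norm_datum (K : ℝ) (x : ℝ²) : ‖(Tc).symm (exp (I * (K * x 0)))‖ = 1 := by
  rw [LinearIsometryEquiv.norm_map]; exact norm_exp_I_mul_mul K (x 0)

/-- The datum `x ↦ Tc⁻¹ e^{iKx₀}` is `K`-Lipschitz (`K ≥ 0`). [folklore] -/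
private theorem dist_datum_le {K : ℝ} (hK : 0 ≤ K) (x y : ℝ²) :
    dist ((Tc).symm (exp (I * (K * x 0)))) ((Tc).symm (exp (I * (K * y 0)))) ≤ K * dist x y := by
  rw [dist_eq_norm, ← map_sub, LinearIsometryEquiv.norm_map, dist_eq_norm]
  have e : exp (I * (K * x 0)) = exp (I * (K * y 0)) * exp (I * ((K * (x 0 - y 0) : ℝ) : ℂ)) := by
    rw [← Complex.exp_add]; congr 1; push_cast; ring
  rw [e, ← mul_sub_one, norm_mul, norm_exp_I_mul_mul, one_mul]
  calc ‖exp (I * ((K * (x 0 - y 0) : ℝ) : ℂ)) - 1‖ ≤ ‖K * (x 0 - y 0)‖ :=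
        Real.norm_exp_I_mul_ofReal_sub_one_le
    _ = K * |x 0 - y 0| := by rw [Real.norm_eq_abs, abs_mul, abs_of_nonneg hK]
    _ ≤ K * ‖x - y‖ := mul_le_mul_of_nonneg_left (abs_apply_zero_sub_le x y) hK

/-- On the outer half `‖x‖ ≥ 1/2` of the disc, `d(x, ∂B ∪ {0}) ≥ 1 − ‖x‖`. [folklore] -/
private theorem one_sub_norm_le_infDist_union {x : ℝ²} (hx : 1 / 2 ≤ ‖x‖) :
    1 - ‖x‖ ≤ infDist x (sphere (0 : ℝ²) 1 ∪ {0}) := by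
  have hne : (sphere (0 : ℝ²) 1 ∪ {0}).Nonempty := ⟨0, Or.inr rfl⟩
  refine (le_infDist hne).mpr fun y hy => ?_
  rcases hy with hy | hy
  · have h1 := le_infDist_sphere (n := 2) (by norm_num) 0 x
    rw [sub_zero] at h1
    exact (le_infDist ⟨y, hy⟩).mp h1 hy
  · rw [mem_singleton_iff] at hy
    rw [hy, dist_zero_right]
    linarith

end Obstruction

open Obstruction

/-! ### 7. The two refutations -/

/-- **Theorem A.3, uncapped reading, is FALSE for `M = S¹ ⊂ ℝ²`, `n = 2`.**  There is NO sequence of constants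
`c_m` such that every Lipschitz `f : B → S¹` (closed unit disc `B ⊂ ℝ²`) admits `f^s : B → S¹`, continuous on `B`,
`C^∞` inside, `= f` on `∂B`, with `‖D^m f^s(x)‖ ≤ c_m d(x, ∂B)^{−(m−1)} Λ₁(f)` for all `m ≥ 1` — i.e.
`¬ ThmA3Cont 2 2 (sphere 0 1)`.  Witness: `f(x) = e^{iKx₀}` with `K = 4(2|c₂| + |c₁|) + 1`; the chord obstruction
(`chord_obstruction`, `h₀ = 0`, `C₁ = |c₁|K`, `C₂ = |c₂|K`, using `d(x, ∂B) = 1 − |x|`) gives `2K ≤ π√((2|c₂| + |c₁|)K)`,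
i.e. `4K ≤ π²(2|c₂| + |c₁|) ≤ 16(2|c₂| + |c₁|) = 4(K − 1)`.  Consequently the declaration of record for row F4.ThmA.3 is
the CAPPED form `ThmA3ContCap` (print's p. 339 «Caution. The geometric theorems of Appendix A, require a universal bound on
`Λ₁` of `φ`'s (as scaled to unit scale)»), which this obstruction does not touch (it only forces `c_m(c₁)` to grow with
the cap).  [cite: Federbush1988PhaseCellIV, Theorem A.3 (A.25)–(A.26) p. 342; «Caution» p. 339] -/
theorem not_thmA3Cont_two_circle :
    ¬ ThmA3Cont 2 2 (sphere (0 : EuclideanSpace ℝ (Fin 2)) 1) := by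
  rintro ⟨c, hc⟩
  -- constants and the frequency `K` of the datum
  set c₁ : ℝ := |c 1| with hc₁def
  set c₂ : ℝ := |c 2| with hc₂def
  have hc₁ : 0 ≤ c₁ := abs_nonneg _
  have hc₂ : 0 ≤ c₂ := abs_nonneg _
  set Kr : ℝ := 4 * (2 * c₂ + c₁) + 1 with hKr
  have hKr0 : 0 ≤ Kr := by rw [hKr]; positivity
  set K : ℝ≥0 := ⟨Kr, hKr0⟩ with hKdef
  have hKcoe : (K : ℝ) = Kr := rfl
  -- the datum `f = e^{iKx₀}` on `B`, values in `S¹`, `K`-Lipschitz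
  let f : ↥(closedBall (0 : ℝ²) 1) → ↥(sphere (0 : ℝ²) 1) := fun x =>
    ⟨(Tc).symm (exp (I * (Kr * (x : ℝ²) 0))), mem_sphere_zero_iff_norm.mpr (norm_datum Kr x)⟩
  have hf : LipschitzWith K f := LipschitzWith.of_dist_le_mul fun x y => by
    rw [Subtype.dist_eq, Subtype.dist_eq, hKcoe]
    exact dist_datum_le hKr0 (x : ℝ²) y
  obtain ⟨fs, hmaps, hbdry, hcont, hsmooth, hbounds⟩ := hc f ⟨K, hf⟩
  -- the chords
  set S : ℝ → ℝ := fun h => √(1 - h ^ 2) with hSdef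
  have hS : ∀ h, S h = √(1 - h ^ 2) := fun _ => rfl
  set P : ℝ → ℝ → ℝ² := fun h τ => (S h * Real.sin τ) • e₀ + h • e₁ with hPdef
  have hP : ∀ h τ, P h τ = (S h * Real.sin τ) • e₀ + h • e₁ := fun _ _ => rfl
  have hIcc_sq : ∀ h ∈ Icc (0 : ℝ) 1, h ^ 2 ≤ 1 := fun h hh => by nlinarith [hh.1, hh.2]
  have hIco_sq : ∀ h ∈ Ico (0 : ℝ) 1, h ^ 2 < 1 := fun h hh => by nlinarith [hh.1, hh.2]
  have hPD : ∀ h ∈ Icc (0 : ℝ) 1, ∀ τ ∈ Icc (-(π / 2)) (π / 2), P h τ ∈ closedBall (0 : ℝ²) 1 := by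
    intro h hh τ _
    rw [mem_closedBall_zero_iff, hP, hS]
    exact norm_chordPt_le (hIcc_sq h hh) τ
  have hPU : ∀ h ∈ Ico (0 : ℝ) 1, ∀ τ ∈ Ioo (-(π / 2)) (π / 2), P h τ ∈ ball (0 : ℝ²) 1 := by
    intro h hh τ hτ
    rw [mem_ball_zero_iff, hP, hS]
    exact norm_chordPt_lt (hIco_sq h hh) hτ
  have hunit : ∀ h ∈ Icc (0 : ℝ) 1, ∀ τ ∈ Icc (-(π / 2)) (π / 2), ‖fs (P h τ)‖ = 1 :=
    fun h hh τ hτ => mem_sphere_zero_iff_norm.mp (hmaps (hPD h hh τ hτ))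
  have hbd : ∀ h ∈ Icc (0 : ℝ) 1, ∀ τ : ℝ, (τ = -(π / 2) ∨ τ = π / 2) →
      Tc (fs (P h τ)) = exp (I * (Kr * (S h * Real.sin τ))) := by
    intro h hh τ hτ
    have hcos : Real.cos τ = 0 := by
      rcases hτ with rfl | rfl
      · rw [Real.cos_neg, Real.cos_pi_div_two]
      · exact Real.cos_pi_div_two
    have hsph : P h τ ∈ sphere (0 : ℝ²) 1 := by
      have h1 := norm_sq_chordPt (hIcc_sq h hh) τ
      rw [hcos, ← hS, ← hP] at h1
      rw [mem_sphere_zero_iff_norm]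
      nlinarith [norm_nonneg (P h τ)]
    have e : fs (P h τ) = (Tc).symm (exp (I * (Kr * (P h τ) 0))) := hbdry ⟨P h τ, hsph⟩
    rw [e, LinearIsometryEquiv.apply_symm_apply, hP, lin_apply_zero, Complex.ofReal_mul]
  have hb1 : ∀ h ∈ Ico (0 : ℝ) 1, ∀ τ ∈ Ioo (-(π / 2)) (π / 2), ‖fderiv ℝ fs (P h τ)‖ ≤ c₁ * Kr := by
    intro h hh τ hτ
    have h1 := hbounds 1 le_rfl K hf (P h τ) (hPU h hh τ hτ)
    rw [show (1 - 1 : ℕ) = 0 from rfl, pow_zero, mul_one, norm_iteratedFDeriv_one, hKcoe] at h1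
    exact h1.trans (mul_le_mul_of_nonneg_right (le_abs_self _) hKr0)
  have hb2 : ∀ h ∈ Ico (0 : ℝ) 1, ∀ τ ∈ Ioo (-(π / 2)) (π / 2),
      ‖iteratedFDeriv ℝ 2 fs (P h τ)‖ * (1 - ‖P h τ‖) ≤ c₂ * Kr := by
    intro h hh τ hτ
    have hx := hPU h hh τ hτ
    have hlt : ‖P h τ‖ < 1 := mem_ball_zero_iff.mp hx
    have hpos : 0 < 1 - ‖P h τ‖ := by linarith
    have hd : 1 - ‖P h τ‖ ≤ infDist (P h τ) (sphere (0 : ℝ²) 1) := by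
      have := le_infDist_sphere (n := 2) (by norm_num) 0 (P h τ)
      rwa [sub_zero] at this
    have hdpos : 0 < infDist (P h τ) (sphere (0 : ℝ²) 1) := hpos.trans_le hd
    have h2 := hbounds 2 (by norm_num) K hf (P h τ) hx
    rw [show (2 - 1 : ℕ) = 1 from rfl, pow_one, hKcoe] at h2
    have i0 : 0 ≤ (infDist (P h τ) (sphere (0 : ℝ²) 1))⁻¹ := inv_nonneg.mpr hdpos.le
    have i1 : (infDist (P h τ) (sphere (0 : ℝ²) 1))⁻¹ ≤ (1 - ‖P h τ‖)⁻¹ := inv_anti₀ hpos hd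
    have h3 : c 2 * (infDist (P h τ) (sphere (0 : ℝ²) 1))⁻¹ * Kr ≤ c₂ * (1 - ‖P h τ‖)⁻¹ * Kr :=
      mul_le_mul_of_nonneg_right
        ((mul_le_mul_of_nonneg_right (le_abs_self _) i0).trans (mul_le_mul_of_nonneg_left i1 hc₂)) hKr0
    calc ‖iteratedFDeriv ℝ 2 fs (P h τ)‖ * (1 - ‖P h τ‖)
        ≤ c₂ * (1 - ‖P h τ‖)⁻¹ * Kr * (1 - ‖P h τ‖) := mul_le_mul_of_nonneg_right (h2.trans h3) hpos.le
      _ = c₂ * Kr := by field_simp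
  -- the obstruction at `h₀ = 0`
  have key : 2 * Kr * S 0 ≤ π * √(2 * (c₂ * Kr) + c₁ * Kr) :=
    chord_obstruction S hS P hP le_rfl one_pos hKr0 (by positivity) isOpen_ball
      (contDiffOn_infty.mp hsmooth 2) hPU hcont hPD hunit hbd hb1 hb2
  -- arithmetic: `S 0 = 1`; square; `π² ≤ 16`
  have hS0 : S 0 = 1 := by rw [hS]; simp
  rw [hS0, mul_one] at key
  have hQ : 0 ≤ (2 * c₂ + c₁) * Kr := by positivity
  have hsq : 4 * Kr ^ 2 ≤ π ^ 2 * ((2 * c₂ + c₁) * Kr) := by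
    have h0 : 0 ≤ 2 * Kr := by positivity
    have h1 := pow_le_pow_left₀ h0 key 2
    simp only [mul_pow] at h1
    rw [Real.sq_sqrt (by positivity)] at h1
    nlinarith
  have hπ : π ^ 2 ≤ 16 := by nlinarith [Real.pi_le_four, Real.pi_pos]
  have h16 : π ^ 2 * ((2 * c₂ + c₁) * Kr) ≤ 16 * ((2 * c₂ + c₁) * Kr) :=
    mul_le_mul_of_nonneg_right hπ hQ
  have hid : 16 * ((2 * c₂ + c₁) * Kr) = 4 * (Kr - 1) * Kr := by rw [hKr]; ring
  nlinarith

/-- **Theorem A.4, uncapped reading, is FALSE for `M = S¹ ⊂ ℝ²`, `n = 2`.**  There is NO sequence of constants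
`c_m` such that every Lipschitz `f : ∂B → S¹` admits `f^{es}`, continuous on `B − x₀` with values in `S¹`, `C^∞` on
the open punctured disc, `= f` on `∂B`, with `‖D^m f^{es}(x)‖ ≤ c_m d(x, ∂B ∪ x₀)^{−(m−1)} |x − x₀|^{−1} Λ₁(f)` — i.e.
`¬ ThmA4Cont 2 2 (sphere 0 1)`.  Witness: `x₀ = 0`, `f(x) = e^{iKx₀}` on the circle with `K = 11(2|c₂| + |c₁|) + 1`;
on the chords at heights `h ∈ [1/2, 1)` one has `|x| ≥ 1/2`, so `|x|⁻¹ ≤ 2` and `d(x, ∂B ∪ {0}) ≥ 1 − |x|`, and the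
chord obstruction (`h₀ = 1/2`, `C₁ = 2|c₁|K`, `C₂ = 2|c₂|K`) gives `√3·K ≤ π√(2(2|c₂| + |c₁|)K)`, i.e.
`3K ≤ 2π²(2|c₂| + |c₁|) ≤ 32(2|c₂| + |c₁|) < 3(K − 1)`.  Consequently the declaration of record for row F4.ThmA.4 is the
CAPPED form `ThmA4ContCap` (p. 339 «Caution»).
[cite: Federbush1988PhaseCellIV, Theorem A.4 (A.32)–(A.36) pp. 342–343; «Caution» p. 339] -/
theorem not_thmA4Cont_two_circle :
    ¬ ThmA4Cont 2 2 (sphere (0 : EuclideanSpace ℝ (Fin 2)) 1) := by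
  rintro ⟨c, hc⟩
  set c₁ : ℝ := |c 1| with hc₁def
  set c₂ : ℝ := |c 2| with hc₂def
  have hc₁ : 0 ≤ c₁ := abs_nonneg _
  have hc₂ : 0 ≤ c₂ := abs_nonneg _
  set Kr : ℝ := 11 * (2 * c₂ + c₁) + 1 with hKr
  have hKr0 : 0 ≤ Kr := by rw [hKr]; positivity
  set K : ℝ≥0 := ⟨Kr, hKr0⟩ with hKdef
  have hKcoe : (K : ℝ) = Kr := rfl
  -- the datum on the circle `∂B` (`x₀ = 0`)
  let f : ↥(sphere (0 : ℝ²) 1) → ↥(sphere (0 : ℝ²) 1) := fun x =>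
    ⟨(Tc).symm (exp (I * (Kr * (x : ℝ²) 0))), mem_sphere_zero_iff_norm.mpr (norm_datum Kr x)⟩
  have hf : LipschitzWith K f := LipschitzWith.of_dist_le_mul fun x y => by
    rw [Subtype.dist_eq, Subtype.dist_eq, hKcoe]
    exact dist_datum_le hKr0 (x : ℝ²) y
  obtain ⟨fs, hmaps, hbdry, hcont, hsmooth, hbounds⟩ := hc 0 f ⟨K, hf⟩
  -- the chords, at heights `h ≥ 1/2`
  set S : ℝ → ℝ := fun h => √(1 - h ^ 2) with hSdef
  have hS : ∀ h, S h = √(1 - h ^ 2) := fun _ => rfl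
  set P : ℝ → ℝ → ℝ² := fun h τ => (S h * Real.sin τ) • e₀ + h • e₁ with hPdef
  have hP : ∀ h τ, P h τ = (S h * Real.sin τ) • e₀ + h • e₁ := fun _ _ => rfl
  have hIcc_sq : ∀ h ∈ Icc (1 / 2 : ℝ) 1, h ^ 2 ≤ 1 := fun h hh => by nlinarith [hh.1, hh.2]
  have hIco_sq : ∀ h ∈ Ico (1 / 2 : ℝ) 1, h ^ 2 < 1 := fun h hh => by nlinarith [hh.1, hh.2]
  have hnorm_ge : ∀ h ∈ Icc (1 / 2 : ℝ) 1, ∀ τ, h ≤ ‖P h τ‖ := by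
    intro h hh τ
    have h1 : h ^ 2 ≤ ‖P h τ‖ ^ 2 := by
      rw [hP, norm_sq_lin]; nlinarith [sq_nonneg (S h * Real.sin τ)]
    exact (le_abs_self h).trans (abs_le_of_sq_le_sq h1 (norm_nonneg _))
  have hne0 : ∀ h ∈ Icc (1 / 2 : ℝ) 1, ∀ τ, P h τ ≠ 0 := by
    intro h hh τ h0
    have := hnorm_ge h hh τ
    rw [h0, norm_zero] at this
    linarith [hh.1]
  have hPD : ∀ h ∈ Icc (1 / 2 : ℝ) 1, ∀ τ ∈ Icc (-(π / 2)) (π / 2),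
      P h τ ∈ closedBall (0 : ℝ²) 1 \ {0} := by
    intro h hh τ _
    refine ⟨?_, hne0 h hh τ⟩
    rw [mem_closedBall_zero_iff, hP, hS]
    exact norm_chordPt_le (hIcc_sq h hh) τ
  have hPU : ∀ h ∈ Ico (1 / 2 : ℝ) 1, ∀ τ ∈ Ioo (-(π / 2)) (π / 2), P h τ ∈ ball (0 : ℝ²) 1 \ {0} := by
    intro h hh τ hτ
    refine ⟨?_, hne0 h (Ico_subset_Icc_self hh) τ⟩
    rw [mem_ball_zero_iff, hP, hS]
    exact norm_chordPt_lt (hIco_sq h hh) hτ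
  have hunit : ∀ h ∈ Icc (1 / 2 : ℝ) 1, ∀ τ ∈ Icc (-(π / 2)) (π / 2), ‖fs (P h τ)‖ = 1 :=
    fun h hh τ hτ => mem_sphere_zero_iff_norm.mp (hmaps (hPD h hh τ hτ))
  have hbd : ∀ h ∈ Icc (1 / 2 : ℝ) 1, ∀ τ : ℝ, (τ = -(π / 2) ∨ τ = π / 2) →
      Tc (fs (P h τ)) = exp (I * (Kr * (S h * Real.sin τ))) := by
    intro h hh τ hτ
    have hcos : Real.cos τ = 0 := by
      rcases hτ with rfl | rfl
      · rw [Real.cos_neg, Real.cos_pi_div_two]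
      · exact Real.cos_pi_div_two
    have hsph : P h τ ∈ sphere (0 : ℝ²) 1 := by
      have h1 := norm_sq_chordPt (hIcc_sq h hh) τ
      rw [hcos, ← hS, ← hP] at h1
      rw [mem_sphere_zero_iff_norm]
      nlinarith [norm_nonneg (P h τ)]
    have e : fs (P h τ) = (Tc).symm (exp (I * (Kr * (P h τ) 0))) := hbdry ⟨P h τ, hsph⟩
    rw [e, LinearIsometryEquiv.apply_symm_apply, hP, lin_apply_zero, Complex.ofReal_mul]
  have hb1 : ∀ h ∈ Ico (1 / 2 : ℝ) 1, ∀ τ ∈ Ioo (-(π / 2)) (π / 2),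
      ‖fderiv ℝ fs (P h τ)‖ ≤ 2 * c₁ * Kr := by
    intro h hh τ hτ
    have hx := hPU h hh τ hτ
    have hge : 1 / 2 ≤ ‖P h τ‖ := hh.1.trans (hnorm_ge h (Ico_subset_Icc_self hh) τ)
    have hnpos : 0 < ‖P h τ‖ := by linarith
    have hinv : ‖P h τ‖⁻¹ ≤ 2 := by rw [inv_le_comm₀ hnpos two_pos]; linarith
    have h1 := hbounds 1 le_rfl K hf (P h τ) hx
    rw [show (1 - 1 : ℕ) = 0 from rfl, pow_zero, mul_one, norm_iteratedFDeriv_one, hKcoe, sub_zero] at h1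
    calc ‖fderiv ℝ fs (P h τ)‖ ≤ c 1 * ‖P h τ‖⁻¹ * Kr := h1
      _ ≤ c₁ * ‖P h τ‖⁻¹ * Kr :=
          mul_le_mul_of_nonneg_right
            (mul_le_mul_of_nonneg_right (le_abs_self _) (inv_nonneg.mpr hnpos.le)) hKr0
      _ ≤ c₁ * 2 * Kr := mul_le_mul_of_nonneg_right (mul_le_mul_of_nonneg_left hinv hc₁) hKr0
      _ = 2 * c₁ * Kr := by ring
  have hb2 : ∀ h ∈ Ico (1 / 2 : ℝ) 1, ∀ τ ∈ Ioo (-(π / 2)) (π / 2),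
      ‖iteratedFDeriv ℝ 2 fs (P h τ)‖ * (1 - ‖P h τ‖) ≤ 2 * c₂ * Kr := by
    intro h hh τ hτ
    have hx := hPU h hh τ hτ
    have hlt : ‖P h τ‖ < 1 := mem_ball_zero_iff.mp hx.1
    have hge : 1 / 2 ≤ ‖P h τ‖ := hh.1.trans (hnorm_ge h (Ico_subset_Icc_self hh) τ)
    have hnpos : 0 < ‖P h τ‖ := by linarith
    have hinv : ‖P h τ‖⁻¹ ≤ 2 := by rw [inv_le_comm₀ hnpos two_pos]; linarith
    have hpos : 0 < 1 - ‖P h τ‖ := by linarith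
    have hd : 1 - ‖P h τ‖ ≤ infDist (P h τ) (sphere (0 : ℝ²) 1 ∪ {0}) :=
      one_sub_norm_le_infDist_union hge
    have hdpos : 0 < infDist (P h τ) (sphere (0 : ℝ²) 1 ∪ {0}) := hpos.trans_le hd
    have h2 := hbounds 2 (by norm_num) K hf (P h τ) hx
    rw [show (2 - 1 : ℕ) = 1 from rfl, pow_one, hKcoe, sub_zero] at h2
    have i0 : 0 ≤ (infDist (P h τ) (sphere (0 : ℝ²) 1 ∪ {0}))⁻¹ := inv_nonneg.mpr hdpos.le
    have i1 : (infDist (P h τ) (sphere (0 : ℝ²) 1 ∪ {0}))⁻¹ ≤ (1 - ‖P h τ‖)⁻¹ := inv_anti₀ hpos hd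
    have a12 : c 2 * (infDist (P h τ) (sphere (0 : ℝ²) 1 ∪ {0}))⁻¹ ≤ c₂ * (1 - ‖P h τ‖)⁻¹ :=
      (mul_le_mul_of_nonneg_right (le_abs_self _) i0).trans (mul_le_mul_of_nonneg_left i1 hc₂)
    have a3 : 0 ≤ c₂ * (1 - ‖P h τ‖)⁻¹ := mul_nonneg hc₂ (inv_nonneg.mpr hpos.le)
    have h3 : c 2 * (infDist (P h τ) (sphere (0 : ℝ²) 1 ∪ {0}))⁻¹ * ‖P h τ‖⁻¹ * Kr
        ≤ c₂ * (1 - ‖P h τ‖)⁻¹ * 2 * Kr :=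
      mul_le_mul_of_nonneg_right (mul_le_mul a12 hinv (inv_nonneg.mpr hnpos.le) a3) hKr0
    calc ‖iteratedFDeriv ℝ 2 fs (P h τ)‖ * (1 - ‖P h τ‖)
        ≤ c₂ * (1 - ‖P h τ‖)⁻¹ * 2 * Kr * (1 - ‖P h τ‖) :=
          mul_le_mul_of_nonneg_right (h2.trans h3) hpos.le
      _ = 2 * c₂ * Kr := by field_simp
  -- the obstruction at `h₀ = 1/2`
  have key : 2 * Kr * S (1 / 2) ≤ π * √(2 * (2 * c₂ * Kr) + 2 * c₁ * Kr) :=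
    chord_obstruction S hS P hP (by norm_num) (by norm_num) hKr0 (by positivity)
      (isOpen_ball.sdiff isClosed_singleton) (contDiffOn_infty.mp hsmooth 2) hPU hcont hPD hunit hbd hb1 hb2
  -- arithmetic: `S(1/2)² = 3/4`; square; `π² ≤ 16`
  have hS2 : S (1 / 2) ^ 2 = 3 / 4 := by rw [hS, Real.sq_sqrt (by norm_num)]; norm_num
  have hQ : 0 ≤ (2 * c₂ + c₁) * Kr := by positivity
  have hsq : 3 * Kr ^ 2 ≤ π ^ 2 * (2 * ((2 * c₂ + c₁) * Kr)) := by
    have h0 : 0 ≤ 2 * Kr * S (1 / 2) := by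
      have : 0 ≤ S (1 / 2) := by rw [hS]; exact Real.sqrt_nonneg _
      positivity
    have h1 := pow_le_pow_left₀ h0 key 2
    simp only [mul_pow] at h1
    rw [hS2, Real.sq_sqrt (by positivity)] at h1
    nlinarith
  have hπ : π ^ 2 ≤ 16 := by nlinarith [Real.pi_le_four, Real.pi_pos]
  have h16 : π ^ 2 * (2 * ((2 * c₂ + c₁) * Kr)) ≤ 16 * (2 * ((2 * c₂ + c₁) * Kr)) :=
    mul_le_mul_of_nonneg_right hπ (by positivity)
  have hid : 33 * ((2 * c₂ + c₁) * Kr) = 3 * (Kr - 1) * Kr := by rw [hKr]; ring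
  nlinarith

/-- Summary for the fold: both uncapped re-typings fail on the unit circle, so rows F4.ThmA.3 / F4.ThmA.4 carry the
capped forms `ThmA3ContCap` / `ThmA4ContCap` (Theorem A.3/A.4 WITH the p. 339 «Caution») as declarations of record.
[cite: Federbush1988PhaseCellIV, Theorems A.3–A.4 pp. 342–343; «Caution» p. 339] -/
theorem not_thmA3Cont_and_not_thmA4Cont_two_circle :
    ¬ ThmA3Cont 2 2 (sphere (0 : EuclideanSpace ℝ (Fin 2)) 1) ∧
      ¬ ThmA4Cont 2 2 (sphere (0 : EuclideanSpace ℝ (Fin 2)) 1) :=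
  ⟨not_thmA3Cont_two_circle, not_thmA4Cont_two_circle⟩

end PhaseCellIVAppA

end

end Literature.MathematicalPhysics.QuantumFieldTheory.Federbush1986
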